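import Literature.AnabelianGeometry.EtaleTheta.Discharge.Sec3Prop34CnstOfRlfRTreeModel
import Literature.AnabelianGeometry.EtaleTheta.PiNNRatPrimeCoordinates
import Literature.AnabelianGeometry.EtaleTheta.TemperedFrobenioidCnst
import Literature.AnabelianGeometry.EtaleTheta.RealifiedDivisorMonoidsOfRlfR
import Literature.AnabelianGeometry.EtaleTheta.FrdIVocabulary
import HarnessLib

/-!
# [EtTh] Prop 3.4 (ii) / Def 3.6 (i), `Λ = ℝ`, at TREE-LIKE tempered coverings — the TREE MODEL, part 2: the
# Def. 3.3 (iii) data with the dual-graph law (L) on the 3-regular tree; Prop. 3.4 and `Prop34Cnst₀` HOLD; the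
# divisors of the golden harmonic pair and of the constants

MODEL companion (carries the definitions of its witness) in the series `Discharge/Sec3*.lean`, cell abc-iut, sub-DAG
`plan/L2/SUBDAG-EtTh-Thm37.md`, row «EtTh:Thm3.7(iii)/L10-R», GAP-LEDGER G-w5d130-1.  Part 1
(`Sec3Prop34CnstOfRlfRTreeModel.lean`): the tree `T₃ = ℤ × ℕ`, its Laplacian `lap`, the integer minimum principle
`const_of_lap_nonpos_of_nonneg`, the golden harmonic pair `hA`, `hB` (integer-valued, harmonic, `hA + φ·hB > 0`, not
constant).  Part 3 (`Sec3Prop34CnstOfRlfRTreeModelNegative.lean`): the `Λ = ℝ` effective-locus clause `hE` FAILS at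
these data.  S. Mochizuki, *The étale theta function …*, Publ. RIMS **45** (2009) [EtTh], §3, Def. 3.3 (iii) p.73,
Prop. 3.4 (ii) p.74, Def. 3.6 (i) p.76, Thm. 3.7 (iii) p.79 (PDF pages) [cite: MochizukiEtTh2009, Prop 3.4 (ii) p.74];
[FrdI] Def. 2.4 (i) p.47 [cite: MochizukiFrdI2008, Def. 2.4(i) p.47].

THIS FILE — the Def. 3.3 (iii) data `dm` over the one-object base built by the SAME recipe as the chain model
(p437249, `Sec3Prop34CnstOfRlfRChainModel.lean`) with the chain `ℤ` replaced by the tree `T₃`: `Prime = V ⊔ V`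
(components ⊔ one cusp per component), `Φ₀ := ∏_{V ⊔ V} ℚ_{≥0}` (perf-factorial, every `M^pf_𝔮` a `ℚ`-prime: `hpf`,
`hQ`), `B₀ := (V → ℤ)` (all integer component-order functions) with the dual-graph LAW (L) `D φ = (φ, −lap φ)`
(`divH`; non-archimedean Poisson–Jensen on the skeleton), `F₀ :=` constants.  PROVED: the `B₀`-level effective-locus
clause (`mem_consts_of_divH_eq_of`, from part 1's integer minimum principle), hence `dm.Prop34` over the tree's [FrdI]
vocabularies (`prop34`) and `dm.Prop34Cnst₀ (𝟭 _)` (`prop34Cnst₀`) — Prop. 3.4 (ii) HOLDS at tree-like data; the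
divisors of the harmonic pair are cusp-free (`divH_gA`, `divH_gB`: `div(hA) = (hA, 0)`, `div(hB) = (hB, 0)`); and the
structure of the constants' divisor group: every element of `Φ₀^cnst(Y₀)` is `toGp (n, 0)`, `n ∈ ℤ`
(`exists_eq_toGp_of_mem_cnstGp`).  HONEST FRAMING: a MODEL over the cell's abstract interfaces; the dictionary to
the genuine tree-like coverings `Z∞` (universal combinatorial coverings of filter members with `b₁ ≥ 2`; analytic
units with prescribed harmonic component orders after van der Put 1992) is stated in part 3's docstring and is NOT
kernel-checked; nothing here bears on [IUTchIII] Cor. 3.12; typed ≠ proved.  Seat abc-iut-w6-d046 (gen 3).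
-/

noncomputable section

namespace Literature.AnabelianGeometry.EtaleTheta

open CategoryTheory Opposite Literature.AlgebraicGeometry.Frobenioids NNReal Real

namespace Sec3Prop34CnstOfRlfRTreeModel

/-! ### The tree data: primes `= V ⊔ V` (components ⊔ cusps), `Φ₀ = ∏ ℚ_{≥0}`, `B₀ = (V → ℤ)` with the law (L) -/

/-- The prime index set: components `inl v` and cusps `inr v` (one cusp attached to each component).
[cite: MochizukiEtTh2009, Def 3.3 p.73] -/
abbrev I : Type := V ⊕ V
/-- `Φ₀ := ∏_{V ⊔ V} ℚ_{≥0}` (multiplicatively). [cite: MochizukiEtTh2009, Def 3.3 p.73] -/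
abbrev M : Type := I → Multiplicative ℚ≥0

/-- **The law (L)**: the divisor of the function with component orders `φ` — components `φ(v)`, cusps `−lap φ(v)`
(non-archimedean Poisson–Jensen on the skeleton). [cite: MochizukiEtTh2009, Def 3.3 p.73] -/
def D (φ : V → ℤ) : I → ℤ
  | Sum.inl v => φ v
  | Sum.inr v => -lap φ v

/-- `D` at a component. [cite: MochizukiEtTh2009, Def 3.3 p.73] -/
@[simp] theorem D_inl (φ : V → ℤ) (v : V) : D φ (Sum.inl v) = φ v := rfl
/-- `D` at a cusp. [cite: MochizukiEtTh2009, Def 3.3 p.73] -/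
@[simp] theorem D_inr (φ : V → ℤ) (v : V) : D φ (Sum.inr v) = -lap φ v := rfl

/-- `D` is additive. [cite: MochizukiEtTh2009, Def 3.3 p.73] -/
theorem D_add (φ ψ : V → ℤ) : D (φ + ψ) = D φ + D ψ := by
  funext i
  rcases i with v | v
  · rfl
  · simp only [D_inr, Pi.add_apply, lap_add]
    ring

/-- `D 0 = 0`. [cite: MochizukiEtTh2009, Def 3.3 p.73] -/
theorem D_zero : D (0 : V → ℤ) = 0 := by
  funext i
  rcases i with v | v
  · rfl
  · simp [D_inr, lap]

/-- `D` as an additive homomorphism (multiplicative notation). [cite: MochizukiEtTh2009, Def 3.3 p.73] -/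
def DHom : Multiplicative (V → ℤ) →* Multiplicative (I → ℤ) :=
  AddMonoidHom.toMultiplicative
    { toFun := D
      map_zero' := D_zero
      map_add' := D_add }

/-- `B₀ := (V → ℤ)` (the component-order functions, multiplicatively). [cite: MochizukiEtTh2009, Def 3.3 p.73] -/
abbrev B : Type := Multiplicative (V → ℤ)

/-- `B₀ → Φ₀^gp`, `φ ↦ [D φ]` (the divisor of `φ` under the law (L)). [cite: MochizukiEtTh2009, Def 3.3 p.73] -/
def divH : B →* Algebra.GrothendieckGroup M := PiNNRat.toGpHom.comp DHom

/-- `divH φ = toGp (D φ)`. [cite: MochizukiEtTh2009, Def 3.3 p.73] -/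
theorem divH_apply (g : B) : divH g = PiNNRat.toGp (D (Multiplicative.toAdd g)) := rfl

/-- `F₀ := the constant functions` (divisor `c · Σ_v C_v`, no cusps). [cite: MochizukiEtTh2009, Def 3.3 p.73] -/
def consts : Submonoid B where
  carrier := {g | ∃ c : ℤ, Multiplicative.toAdd g = fun _ => c}
  one_mem' := ⟨0, rfl⟩
  mul_mem' := by
    rintro g g' ⟨c, hc⟩ ⟨c', hc'⟩
    refine ⟨c + c', ?_⟩
    rw [toAdd_mul, hc, hc']
    rfl

/-- **The tree data `(Φ₀, B₀, B₀ → Φ₀^gp, F₀)`** over the one-object base category (cuspidal splitting not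
modelled: everything non-cuspidal). [cite: MochizukiEtTh2009, Def 3.3 p.73] -/
def dm : DivisorMonoids.{0, 0, 0} (Discrete PUnit.{1}) where
  Φ₀ := (Functor.const _).obj (CommMonCat.of M)
  B₀ := (Functor.const _).obj (CommMonCat.of B)
  isUnit_B₀ _ b := by
    change IsUnit (M := B) b
    exact Group.isUnit _
  div₀ _ := divH
  div₀_natural _ b := by
    change divH b = gpMap (MonoidHom.id M) (divH b)
    rw [gpMap_eq_monGpMap, MonGp.map_id, MonoidHom.id_apply]
  F₀ _ := consts
  F₀_map _ _ hb := hb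
  ncsp₀ _ := ⊤
  csp₀ _ := ⊥
  ncsp₀_map _ _ _ := trivial
  csp₀_map _ x hx := by
    rw [Submonoid.mem_bot] at hx ⊢
    rw [hx, map_one]
  existsUnique_ncsp_csp _ x := by
    refine ⟨(⟨x, trivial⟩, ⟨1, Submonoid.mem_bot.mpr rfl⟩), mul_one x, ?_⟩
    rintro ⟨a, c⟩ h
    have hc : c.1 = 1 := Submonoid.mem_bot.mp c.2
    have ha : a.1 = x := by
      have h' : a.1 * c.1 = x := h
      rwa [hc, mul_one] at h'
    exact Prod.ext (Subtype.ext ha) (Subtype.ext hc)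

/-- `Φ₀(Y) = ∏_{V ⊔ V} ℚ_{≥0}` is perf-factorial at every object. [cite: MochizukiEtTh2009, Prop 3.4 p.74] -/
theorem hpf : ∀ Y : (Discrete PUnit.{1})ᵒᵖ, IsPerfFactorial (dm.Φ₀.obj Y) := fun _ => PiNNRat.isPerfFactorial

/-- Every `Φ₀(Y)^pf_𝔮` is `ℚ`-monoprime. [cite: MochizukiFrdI2008, Def. 2.4(i) p.47] -/
theorem hQ (Y : Discrete PUnit.{1}) (𝔮 : Primes (Perfection (dm.Φ₀.obj (op Y)))) :
    IsQMonoprime (PfAt (dm.Φ₀.obj (op Y)) 𝔮) :=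
  PiNNRat.isQMonoprime_pfAt 𝔮

/-- **The `B₀`-level effective-locus clause at the tree model**: if `div(φ) = (φ, −lap φ)` is effective then `φ`
is constant (integer minimum principle). [cite: MochizukiEtTh2009, Prop 3.4 (ii) p.74] -/
theorem mem_consts_of_divH_eq_of (g : B) (x : M) (hg : divH g = Algebra.GrothendieckGroup.of x) : g ∈ consts := by
  have hnn : ∀ i, 0 ≤ D (Multiplicative.toAdd g) i := PiNNRat.nonneg_of_toGp_eq_of hg
  refine ⟨Multiplicative.toAdd g (0, 0), funext fun v => ?_⟩
  refine const_of_lap_nonpos_of_nonneg (Multiplicative.toAdd g) (fun w => ?_) (fun w => ?_) v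
  · have h1 := hnn (Sum.inr w)
    rw [D_inr] at h1
    omega
  · exact hnn (Sum.inl w)

/-- **Prop. 3.4 for the tree data over the TREE's [FrdI] vocabulary**: perf-factorial, non-dilating, divisorial,
and — the clauses with content — kernel and effective locus of `B₀ → Φ₀^gp` inside the constants.
[cite: MochizukiEtTh2009, Prop 3.4 p.74] -/
theorem prop34 (IsRat IsSRat : ((Discrete PUnit.{1})ᵒᵖ ⥤ CommMonCat.{0}) → Prop) :
    dm.Prop34 treeMonoidVocab (treeCatVocab (Discrete PUnit.{1}) IsRat IsSRat) where
  isPerfFactorial Y := hpf Y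
  isNonDilating Y f _ := by
    change associatesMap (MonoidHom.id M) = MonoidHom.id _
    ext x
    obtain ⟨m, rfl⟩ := Associates.mk_surjective x
    rw [associatesMap_mk]
    rfl
  isDivisorialOn := by
    refine ⟨⟨fun α => ⟨fun a b h => h, fun x y h => ?_⟩, fun α _ => Function.bijective_id⟩,
      fun _ => PiNNRat.isDivisorial⟩
    obtain ⟨a, rfl⟩ := Associates.mk_surjective x
    obtain ⟨b, rfl⟩ := Associates.mk_surjective y
    rw [associatesMap_mk, associatesMap_mk] at h
    exact h
  ker_div₀_le_F₀ Y g hg := by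
    change divH g = 1 at hg
    exact mem_consts_of_divH_eq_of g 1 (by rw [hg, map_one])
  mem_F₀_of_div₀_mem Y g x hg := mem_consts_of_divH_eq_of g x hg

/-- `Prop34Cnst₀` for the tree data and `cnst := 𝟭` (the one-object base has only identity morphisms).
[cite: MochizukiEtTh2009, Prop 3.4 (ii) p.74] -/
theorem prop34Cnst₀ : dm.Prop34Cnst₀ (𝟭 (Discrete PUnit.{1})) where
  B₀_map_eq_of_cnst_map_eq g g' _ _ _ := by rw [Subsingleton.elim g g']
  Φ₀_map_eq_of_cnst_map_eq g g' _ _ _ := by rw [Subsingleton.elim g g']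
  cnst_map_eq_of_B₀_map_eq g g' _ := Subsingleton.elim _ _

/-- `D hA = (hA, 0)`: the divisor of the harmonic `hA` has no cusps. [cite: MochizukiEtTh2009, Def 3.3 p.73] -/
theorem D_A (i : I) : D hA i = Sum.elim hA (fun _ => 0) i := by
  rcases i with v | v
  · rfl
  · rw [D_inr, lap_A, neg_zero, Sum.elim_inr]
/-- `D hB = (hB, 0)`: no cusps. [cite: MochizukiEtTh2009, Def 3.3 p.73] -/
theorem D_B (i : I) : D hB i = Sum.elim hB (fun _ => 0) i := by
  rcases i with v | v
  · rfl
  · rw [D_inr, lap_B, neg_zero, Sum.elim_inr]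

/-- The elements `hA, hB ∈ B₀(Y)` (the component-order functions of two analytic UNITS under the dictionary).
[cite: MochizukiEtTh2009, Def 3.3 p.73] -/
def gA : B := Multiplicative.ofAdd hA
/-- See `gA`. [cite: MochizukiEtTh2009, Def 3.3 p.73] -/
def gB : B := Multiplicative.ofAdd hB

/-- `divH gA = toGp (hA, 0)`. [cite: MochizukiEtTh2009, Def 3.3 p.73] -/
theorem divH_gA : divH gA = PiNNRat.toGp (Sum.elim hA (fun _ => 0)) := by
  rw [divH_apply, gA, toAdd_ofAdd]
  exact congrArg PiNNRat.toGp (funext D_A)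
/-- `divH gB = toGp (hB, 0)`. [cite: MochizukiEtTh2009, Def 3.3 p.73] -/
theorem divH_gB : divH gB = PiNNRat.toGp (Sum.elim hB (fun _ => 0)) := by
  rw [divH_apply, gB, toAdd_ofAdd]
  exact congrArg PiNNRat.toGp (funext D_B)


/-! ### Constants: the subgroup `Φ₀^cnst(Y₀)` generated by the divisors of constants -/

/-- The base object. [cite: MochizukiEtTh2009, Def 3.3 p.73] -/
def Y₀ : Discrete PUnit.{1} := ⟨PUnit.unit⟩

/-- The cusp-free divisor `(hA, 0)` of `gA`. [cite: MochizukiEtTh2009, Def 3.3 p.73] -/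
abbrev dA : I → ℤ := Sum.elim hA (fun _ => 0)
/-- The cusp-free divisor `(hB, 0)` of `gB`. [cite: MochizukiEtTh2009, Def 3.3 p.73] -/
abbrev dB : I → ℤ := Sum.elim hB (fun _ => 0)

/-- The coordinate vector of the integer constant `n`: `n` at the components, `0` at the cusps.
[cite: MochizukiEtTh2009, Def 3.3 p.73] -/
def cvZ (n : ℤ) : I → ℤ := Sum.elim (fun _ => n) (fun _ => 0)

/-- The divisor of the constant `n ∈ F₀`: `D n = (n, 0)`. [cite: MochizukiEtTh2009, Def 3.3 p.73] -/
theorem D_const (n : ℤ) : D (fun _ => n) = cvZ n := by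
  funext i
  rcases i with v | v
  · rfl
  · simp only [D_inr, lap, cvZ, Sum.elim_inr]
    ring

/-- `toGp (n, 0) · toGp (n', 0) = toGp (n + n', 0)`. [cite: MochizukiEtTh2009, Def 3.3 p.73] -/
theorem toGp_cvZ_add (n n' : ℤ) : PiNNRat.toGp (cvZ n) * PiNNRat.toGp (cvZ n') = PiNNRat.toGp (cvZ (n + n')) := by
  rw [← PiNNRat.toGp_add]
  congr 1
  funext i
  rcases i with v | v <;> simp [cvZ]

/-- `toGp (0, 0) = 1`. [cite: MochizukiEtTh2009, Def 3.3 p.73] -/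
theorem toGp_cvZ_zero : PiNNRat.toGp (cvZ 0) = 1 := by
  rw [← PiNNRat.toGp_zero]
  congr 1
  funext i
  rcases i with v | v <;> rfl

/-- `toGp (n, 0)⁻¹ = toGp (−n, 0)`. [cite: MochizukiEtTh2009, Def 3.3 p.73] -/
theorem toGp_cvZ_neg (n : ℤ) : (PiNNRat.toGp (cvZ n))⁻¹ = PiNNRat.toGp (cvZ (-n)) := by
  refine (eq_inv_of_mul_eq_one_right ?_).symm
  rw [toGp_cvZ_add, add_neg_cancel, toGp_cvZ_zero]

/-- **Every element of `Φ₀^cnst(Y₀)` (the group generated by the divisors of constants) is `toGp (n, 0)`**, `n ∈ ℤ`.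
[cite: MochizukiEtTh2009, Def 3.3 p.73] -/
theorem exists_eq_toGp_of_mem_cnstGp {c : Algebra.GrothendieckGroup M} (hc : c ∈ dm.cnstGp.carrier Y₀) :
    ∃ n : ℤ, c = PiNNRat.toGp (cvZ n) := by
  induction hc using Subgroup.closure_induction with
  | mem x hx =>
    obtain ⟨b, ⟨n, hn⟩, rfl⟩ := hx
    refine ⟨n, ?_⟩
    change divH b = _
    rw [divH_apply, hn, D_const]
  | one => exact ⟨0, toGp_cvZ_zero.symm⟩
  | mul x y _ _ ihx ihy =>
    obtain ⟨n, rfl⟩ := ihx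
    obtain ⟨n', rfl⟩ := ihy
    exact ⟨n + n', toGp_cvZ_add n n'⟩
  | inv x _ ih =>
    obtain ⟨n, rfl⟩ := ih
    exact ⟨-n, toGp_cvZ_neg n⟩


end Sec3Prop34CnstOfRlfRTreeModel

end Literature.AnabelianGeometry.EtaleTheta

end
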